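import Mathlib.Analysis.Complex.Basic
import Mathlib.Analysis.SpecialFunctions.Pow.Real
import HarnessLib

/-!
# Venture YMGap — Theorem C (sharp Hessian constant `4d`), kernel part T0.2:
# the ROOT SECTOR of the single-plaquette lemma is positive semidefinite

HONEST FRAMING: venture file (cell `pub-ymgap`, track (a), item A2 = "Theorem C" of
`p2/HESSIAN-SHARP.md`, referee-checked inside the cell, NOT yet kernel-checked as a whole). This file
kernel-checks the second algebraic brick — target T0.2 of `p2/LEAN-TARGETS-A2.md` — and nothing else.

The brick (HESSIAN-SHARP §2, Lemma 2 (SPL), sector (ii)): for a pair `a < b` of eigen-directions of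
the plaquette holonomy `W = diag(e^{iθ})`, the entries `ζ_i = (Y_i)_{ab} ∈ ℂ` of the four link
variables contribute to the slack of SPL the Hermitian form `ζ* M(c,u) ζ` with
`M(c,u) = 2[(2 + c Re u) I + N + N*]`, `N` strictly upper triangular, `N₁₂ = N₂₃ = N₃₄ = 1 + cu`,
`N₁₃ = N₂₄ = cu`, `N₁₄ = cu + u²`, where `c = cos((θ_a+θ_b)/2) ∈ [-1,1]` and `u = e^{-iδ}`,
`δ = (θ_a-θ_b)/2`. CLAIM T0.2: `M(c,u) ⪰ 0` for all `c ∈ [-1,1]`, `|u| = 1`.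

PROOF FORMALISED HERE (p3's reduction, `A2-PORT-SCOPE.md` §Q3, replacing the eigenvalue computation of
HESSIAN-SHARP by an explicit sum of squares): write `u = a²` with `|a| = 1` and `κ = Re a`. Then
`1 + u = 2κa`, `u + u² = 2κa³`, `2 + Re u = 1 + 2κ²`, so `M(1,u)/2 = D* Q(κ) D` with
`D = diag(1,a,a²,a³)` and `Q(κ)` the real symmetric CIRCULANT `circ(1+2κ², 2κ, 1, 2κ)`, whose
Hermitian form is the sum of squares
`η*Qη = ((1+κ)²/2)|η₀+η₁+η₂+η₃|² + ((1-κ)²/2)|η₀-η₁+η₂-η₃|² + κ²(|η₀-η₂|² + |η₁-η₃|²)`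
(`circForm_eq_sos`; eigenvalues `2(1±κ)²`, `2κ²` twice = HESSIAN-SHARP's `(√2±s)², s², s²`,
`s = √2|κ|`). The case `c = -1` is the case `c = 1` at `a ↦ i a` (`u ↦ -u`), and `M(c,u)` is affine in
`c`, so `M(c,u) = ((1+c)/2) M(1,u) + ((1-c)/2) M(-1,u) ⪰ 0` on `c ∈ [-1,1]`.

Everything is written as identities between complex numbers built from `a, conj a, ζ_k, conj ζ_k`
(`rootForm c a ζ = ζ* (M(c,a²)/2) ζ`), so that the proofs are `ring`/`linear_combination`; the only
place where `|a| = 1` enters is `rootForm_one_eq_circFormC` (via `conj a * a = 1`).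

Main results: `rootForm_nonneg` (`0 ≤ Re(ζ* M(c,a²) ζ)` and `Im = 0` for `|c| ≤ 1`, `‖a‖ = 1`).
Reference: `run/shared/lean/pub/pub-ymgap/p2/HESSIAN-SHARP.md` §2 (ii); `p2/LEAN-TARGETS-A2.md` T0.2;
`HOME/lean/A2-PORT-SCOPE.md` §Q3. Background: Shen–Zhu–Zhu, CMP 400 (2023) 805, Lemma 4.1.
-/

noncomputable section

namespace Summit.Ventures.YMGap.HessianSharp

open ComplexConjugate Complex

/-! ### The real circulant `Q(κ) = circ(1+2κ², 2κ, 1, 2κ)` and its sum of squares -/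

/-- The Hermitian form of the circulant `Q(κ) = circ(1+2κ², 2κ, 1, 2κ)`, as a complex number built
from `η` and `conj η` (it is real: `circFormC_eq_sos`). Here `k2 = 2κ` is passed as a complex
parameter (in the application `k2 = a + conj a`). -/
def circFormC (k2 : ℂ) (η : Fin 4 → ℂ) : ℂ :=
  (1 + k2 ^ 2 / 2) * (conj (η 0) * η 0 + conj (η 1) * η 1 + conj (η 2) * η 2 + conj (η 3) * η 3) +
    k2 * (conj (η 0) * η 1 + conj (η 1) * η 2 + conj (η 2) * η 3 + conj (η 0) * η 3 +
      (conj (η 1) * η 0 + conj (η 2) * η 1 + conj (η 3) * η 2 + conj (η 3) * η 0)) +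
    (conj (η 0) * η 2 + conj (η 1) * η 3 + conj (η 2) * η 0 + conj (η 3) * η 1)

/-- **The circulant sum of squares** (with `k2 = 2κ`):
`η*Qη = ((2+k2)²/8)|η₀+η₁+η₂+η₃|² + ((2-k2)²/8)|η₀-η₁+η₂-η₃|² + (k2²/4)(|η₀-η₂|² + |η₁-η₃|²)`, an
identity of polynomials in `η, conj η, k2`. -/
theorem circFormC_eq_sos (k2 : ℂ) (η : Fin 4 → ℂ) :
    circFormC k2 η =
      (2 + k2) ^ 2 / 8 * (conj (η 0 + η 1 + η 2 + η 3) * (η 0 + η 1 + η 2 + η 3)) +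
      (2 - k2) ^ 2 / 8 * (conj (η 0 - η 1 + η 2 - η 3) * (η 0 - η 1 + η 2 - η 3)) +
      k2 ^ 2 / 4 * (conj (η 0 - η 2) * (η 0 - η 2) + conj (η 1 - η 3) * (η 1 - η 3)) := by
  simp only [circFormC, map_add, map_sub]
  ring

/-! ### The root-sector form `ζ* (M(c,u)/2) ζ`, `u = a²` -/

/-- `rootForm c a ζ = ζ* (M(c,a²)/2) ζ` written out: with `u = a²`,
`(2 + c Re u)Σ|ζ_k|² + Σ_{j<k} (N_{jk} conj(ζ_j) ζ_k + conj(N_{jk}) ζ_j conj(ζ_k))`,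
`N₀₁ = N₁₂ = N₂₃ = 1 + cu`, `N₀₂ = N₁₃ = cu`, `N₀₃ = cu + u²` (HESSIAN-SHARP §2 (ii); `Re u` is written
`(u + conj u)/2` and `conj(N)` through `conj a`, so that this is a polynomial in `a, conj a, ζ, conj ζ`). -/
def rootForm (c : ℂ) (a : ℂ) (ζ : Fin 4 → ℂ) : ℂ :=
  (2 + c * (a ^ 2 + conj a ^ 2) / 2) *
      (conj (ζ 0) * ζ 0 + conj (ζ 1) * ζ 1 + conj (ζ 2) * ζ 2 + conj (ζ 3) * ζ 3) +
    ((1 + c * a ^ 2) * (conj (ζ 0) * ζ 1 + conj (ζ 1) * ζ 2 + conj (ζ 2) * ζ 3) +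
      c * a ^ 2 * (conj (ζ 0) * ζ 2 + conj (ζ 1) * ζ 3) + (c * a ^ 2 + a ^ 4) * (conj (ζ 0) * ζ 3)) +
    ((1 + c * conj a ^ 2) * (conj (ζ 1) * ζ 0 + conj (ζ 2) * ζ 1 + conj (ζ 3) * ζ 2) +
      c * conj a ^ 2 * (conj (ζ 2) * ζ 0 + conj (ζ 3) * ζ 1) +
      (c * conj a ^ 2 + conj a ^ 4) * (conj (ζ 3) * ζ 0))

/-- `M(c,u)` is affine in `c`: `M(c) = ((1+c)/2) M(1) + ((1-c)/2) M(-1)`. -/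
theorem rootForm_affine (c a : ℂ) (ζ : Fin 4 → ℂ) :
    rootForm c a ζ = (1 + c) / 2 * rootForm 1 a ζ + (1 - c) / 2 * rootForm (-1) a ζ := by
  unfold rootForm
  ring

/-- `M(-1, u) = M(1, -u)`: the case `c = -1` is the case `c = 1` at `a ↦ i a`
(HESSIAN-SHARP: `M(-1,δ) = M(1,δ+π)`). -/
theorem rootForm_neg_one (a : ℂ) (ζ : Fin 4 → ℂ) :
    rootForm (-1) a ζ = rootForm 1 (I * a) ζ := by
  unfold rootForm
  have hI2 : (I * a) ^ 2 = -a ^ 2 := by rw [mul_pow, I_sq]; ring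
  have hI4 : (I * a) ^ 4 = a ^ 4 := by
    rw [show (4 : ℕ) = 2 * 2 from rfl, pow_mul, hI2]; ring
  have hcI2 : conj (I * a) ^ 2 = -conj a ^ 2 := by rw [map_mul, conj_I, mul_pow, neg_pow_two, I_sq]; ring
  have hcI4 : conj (I * a) ^ 4 = conj a ^ 4 := by
    rw [show (4 : ℕ) = 2 * 2 from rfl, pow_mul, hcI2]; ring
  rw [hI2, hI4, hcI2, hcI4]
  ring

/-- **The twisted change of variables** `η_k = a^k ζ_k`: for `conj a * a = 1` (i.e. `|a| = 1`),
`ζ* (M(1,a²)/2) ζ = η* Q(κ) η` with `2κ = a + conj a` — the circulant reduction. -/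
theorem rootForm_one_eq_circFormC (a : ℂ) (ha : conj a * a = 1) (ζ : Fin 4 → ℂ) :
    rootForm 1 a ζ = circFormC (a + conj a) ![ζ 0, a * ζ 1, a ^ 2 * ζ 2, a ^ 3 * ζ 3] := by
  simp only [rootForm, circFormC, Matrix.cons_val_zero, Matrix.cons_val_one, Matrix.head_cons,
    Matrix.cons_val_two, Matrix.tail_cons, Matrix.cons_val_three, map_mul, map_pow, one_mul]
  -- every use of `|a| = 1` is through `conj a * a = 1`
  linear_combination (-(
      conj (ζ 0) * ζ 0 +
      (conj (ζ 1) * ζ 1) * ((1 + (a ^ 2 + conj a ^ 2) / 2) + (1 + conj a * a)) +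
      (conj (ζ 2) * ζ 2) * ((1 + (a ^ 2 + conj a ^ 2) / 2) * (1 + conj a * a) +
          (1 + conj a * a + (conj a * a) ^ 2)) +
      (conj (ζ 3) * ζ 3) * ((1 + (a ^ 2 + conj a ^ 2) / 2) * (1 + conj a * a + (conj a * a) ^ 2) +
          (1 + conj a * a + (conj a * a) ^ 2 + (conj a * a) ^ 3)) +
      conj (ζ 0) * ζ 1 + conj (ζ 1) * ζ 2 * (a ^ 2 + (conj a * a + 1)) +
        conj (ζ 2) * ζ 3 * (a ^ 2 * (conj a * a + 1) + ((conj a * a) ^ 2 + conj a * a + 1)) +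
        conj (ζ 1) * ζ 3 * a ^ 2 + conj (ζ 0) * ζ 3 * a ^ 2 +
      conj (ζ 1) * ζ 0 + conj (ζ 2) * ζ 1 * ((conj a * a + 1) + conj a ^ 2) +
        conj (ζ 3) * ζ 2 * (((conj a * a) ^ 2 + conj a * a + 1) + conj a ^ 2 * (conj a * a + 1)) +
        conj (ζ 3) * ζ 1 * conj a ^ 2 + conj (ζ 3) * ζ 0 * conj a ^ 2)) * ha

/-! ### Non-negativity -/

/-- The circulant form at `k2 = 2κ` real is the real number
`((2+2κ)²/8)|Ση|² + ((2-2κ)²/8)|Σ(-1)^kη_k|² + κ²(|η₀-η₂|² + |η₁-η₃|²) ≥ 0`. -/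
theorem circFormC_eq_ofReal (κ : ℝ) (η : Fin 4 → ℂ) :
    circFormC ((2 * κ : ℝ) : ℂ) η =
      (((2 + 2 * κ) ^ 2 / 8 * normSq (η 0 + η 1 + η 2 + η 3) +
          (2 - 2 * κ) ^ 2 / 8 * normSq (η 0 - η 1 + η 2 - η 3) +
          (2 * κ) ^ 2 / 4 * (normSq (η 0 - η 2) + normSq (η 1 - η 3)) : ℝ) : ℂ) := by
  rw [circFormC_eq_sos]
  simp only [← normSq_eq_conj_mul_self]
  push_cast
  ring

/-- The real number in `circFormC_eq_ofReal` is non-negative. -/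
theorem circForm_real_nonneg (κ : ℝ) (η : Fin 4 → ℂ) :
    0 ≤ (2 + 2 * κ) ^ 2 / 8 * normSq (η 0 + η 1 + η 2 + η 3) +
        (2 - 2 * κ) ^ 2 / 8 * normSq (η 0 - η 1 + η 2 - η 3) +
        (2 * κ) ^ 2 / 4 * (normSq (η 0 - η 2) + normSq (η 1 - η 3)) := by
  have h0 := normSq_nonneg (η 0 + η 1 + η 2 + η 3)
  have h1 := normSq_nonneg (η 0 - η 1 + η 2 - η 3)
  have h2 := normSq_nonneg (η 0 - η 2)
  have h3 := normSq_nonneg (η 1 - η 3)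
  positivity

/-- **`M(1, a²) ⪰ 0` for `|a| = 1`**: `ζ* (M(1,a²)/2) ζ` is a non-negative real number. -/
theorem rootForm_one_nonneg {a : ℂ} (ha : ‖a‖ = 1) (ζ : Fin 4 → ℂ) :
    ∃ r : ℝ, 0 ≤ r ∧ rootForm 1 a ζ = (r : ℂ) := by
  have ha' : conj a * a = 1 := by
    rw [← normSq_eq_conj_mul_self, normSq_eq_norm_sq, ha]; norm_num
  rw [rootForm_one_eq_circFormC a ha' ζ, add_conj, circFormC_eq_ofReal]
  exact ⟨_, circForm_real_nonneg _ _, rfl⟩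

/-- **`M(-1, a²) ⪰ 0` for `|a| = 1`** (via `a ↦ i a`). -/
theorem rootForm_neg_one_nonneg {a : ℂ} (ha : ‖a‖ = 1) (ζ : Fin 4 → ℂ) :
    ∃ r : ℝ, 0 ≤ r ∧ rootForm (-1) a ζ = (r : ℂ) := by
  rw [rootForm_neg_one]
  refine rootForm_one_nonneg ?_ ζ
  rw [norm_mul, norm_I, one_mul, ha]

/-- **T0.2 — the root sector is positive semidefinite**: for `-1 ≤ c ≤ 1` and `|a| = 1`, the
Hermitian form `ζ* M(c, a²) ζ` of HESSIAN-SHARP §2 (ii) is a non-negative real number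
(`rootForm c a ζ = ζ* (M(c,a²)/2) ζ`). -/
theorem rootForm_nonneg {c : ℝ} (hc : -1 ≤ c) (hc' : c ≤ 1) {a : ℂ} (ha : ‖a‖ = 1)
    (ζ : Fin 4 → ℂ) : ∃ r : ℝ, 0 ≤ r ∧ rootForm (c : ℂ) a ζ = (r : ℂ) := by
  obtain ⟨r₁, hr₁, h₁⟩ := rootForm_one_nonneg ha ζ
  obtain ⟨r₂, hr₂, h₂⟩ := rootForm_neg_one_nonneg ha ζ
  refine ⟨(1 + c) / 2 * r₁ + (1 - c) / 2 * r₂, ?_, ?_⟩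
  · have h1c : 0 ≤ 1 + c := by linarith
    have h2c : 0 ≤ 1 - c := by linarith
    positivity
  · rw [rootForm_affine, h₁, h₂]
    push_cast
    ring

/-- Corollary in `re`/`im` form: `0 ≤ Re(ζ* M(c,a²) ζ)` and `Im(ζ* M(c,a²) ζ) = 0`. -/
theorem rootForm_re_nonneg {c : ℝ} (hc : -1 ≤ c) (hc' : c ≤ 1) {a : ℂ} (ha : ‖a‖ = 1)
    (ζ : Fin 4 → ℂ) : 0 ≤ (rootForm (c : ℂ) a ζ).re ∧ (rootForm (c : ℂ) a ζ).im = 0 := by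
  obtain ⟨r, hr, h⟩ := rootForm_nonneg hc hc' ha ζ
  rw [h]
  exact ⟨by simpa using hr, by simp⟩

end Summit.Ventures.YMGap.HessianSharp
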